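import Literature.MathematicalPhysics.QuantumFieldTheory.Balaban1983to89.B9Ineq344GpAtLetters
import Literature.MathematicalPhysics.QuantumFieldTheory.Balaban1983to89.B9Ineq344CutoffDatumTorus

/-!
# `Balaban1983to89.B9Ineq344LocalToKIdx` — [B9] (3.44)–(3.45) AT U = 1: THE TWO FLAT SCHEMAS `Ineq344GpKIdx` ∕ `Ineq345GpKIdx`
# (row 11 of the N06 knit at def-Y's instance, `B9Ineq344GpAtLetters`) FROM THE LOCAL [B5]-PROP-1.2-TYPE CLAUSES OF A
# COMPARISON OPERATOR AROUND EACH SOURCE BLOCK (`LocalSecondOrderKIdx`) — the dual comparison (FILE 16), the cut-off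
# datum (FILE 17), lit-balaban-p21's members 1 ∕ 4 of (2.67), the (2.60) transfer and the (2.61) count, assembled at every
# k-level V1 index above a threshold

T. Bałaban, *Propagators for lattice gauge theories in a background field*, Commun. Math. Phys. **99** (1985) 389–434
[`Balaban1985BackgroundPropagators`, "B9"]; [4] = T. Bałaban, *Propagators and renormalization transformations for lattice
gauge theories. II*, Commun. Math. Phys. **96** (1984) 223–250 [`Balaban1984PropagatorsII`]; [B5] = T. Bałaban, *Propagators and
renormalization transformations for lattice gauge theories. I*, Commun. Math. Phys. **95** (1984) 17–40 [`Balaban1984PropagatorsI`].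

statement-level skeleton of published theorems with citation tags; proofs where landed; nothing here is a claim about the
Yang–Mills mass gap

THE PRINTED LOCI (verbatim).  [B9] Thm 3.1 (3.44)–(3.45) p. 398; Cor. 3.5 p. 407 (*"For … U = 1, these theorems are proved in [4]"*);
[B5] Prop. 1.2 (1.110), (1.112)–(1.113) p. 36 and the remark *"the choice of derivatives ∇G∇* is accidental; we can take
arbitrary derivatives, like ∂_μG∂_ν, ∂*G∂_ν, ∂*G∂*"*; [4] Lemma 2.1 (2.60)–(2.61) p. 234.

THE POINT.  FILE 15 reduced row 11 to `Ineq344GpKIdx` + `Ineq345GpKIdx`; FILE 16 proved, on p21's torus, that both quantities are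
controlled by local data of ANY comparison pair through the commutator datum `CommDatum`; FILE 17 realised the cut-off half of that
datum.  THIS FILE closes the loop: the hypothesis schema ★ `LocalSecondOrderKIdx` — for every index above a threshold, every
source block `s′` and direction `ν`, SOME pair `(A^c, G^c)` with `G^c` symmetric, `G^cA^c = 1`, `A^c = −Δ + V^c` on the functions
supported over the blocks of `𝒩_{r_loc}(s′)` (`V^c` an `ℓ¹`-contraction of size `C₁L^{−2j′}`), and, for `λ` in `B(s′)`, the LOCAL
clauses (1.110)₃ (`|G^c∂_νᵀλ| ≤ C₁L^{j′}|λ|`), (1.112) (`|∂_κG^c∂_νᵀλ|, |∂_κᵀG^c∂_νᵀλ| ≤ C₂(ε)(‖λ‖_ε + |λ|)` on `𝒩_{r_loc}(s′)`) and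
(1.113) (the one-block-pair `β`-quotient `≤ C₃(ε,β)(‖λ‖_{β+ε} + |λ|)` there) — IMPLIES both flat schemas:
★★ `ineq344GpKIdx_of_local`, ★★ `ineq345GpKIdx_of_local`, hence ★★ `hGp_opsYOfLetters_of_local N θ M⋆ 𝔏 𝔈 hloc` (row 11 of the
N06 knit at the record's layer of letters from `LocalSecondOrderKIdx` alone).

* §1 the schema and its radius `rloc = 2(c₀ + 2(d+1))`;
* §2 arithmetic of the constants (`theta_le`: `Θ ≤ A(C₁,C₂(ε))·(‖λ‖ + |λ|)∕L^{j′}`), the level window on `𝒩_{r_loc}(s′)` (`pow_window_nbhdT`),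
  the (2.60) transfer in the form used (`transfer_one`: `L^{j}e^{−½δ₀d} ≤ L·L^{j′}e^{−⅛δ₀d}`);
* §3 the two commutator data at an index (`commDatum_far`, `commDatum_near`) from FILE 17 and the schema's locality clauses;
* §4 ★★ the assembly.

HONEST SCOPE.  Bookkeeping over FILES 15–17 and p21's programme; the schema `LocalSecondOrderKIdx` is the located residual of row 11
(= [B5] Prop. 1.2's second-order clauses for B4's box operator `G_j(□)` charted into p21's torus; torus twin PROVED:
`B5SecondOrderGpTorus`); it is a HYPOTHESIS here.  Nothing of [B9]∕[4]∕[B5] is asserted; count-neutral; N06 NOT discharged; one finite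
lattice programme — nothing continuum, nothing about the mass gap.  Cell `pub-ymgap` (HUMAN RULING D-0062), Track A node N06 [B9],
N06-ASSIGNMENT v1 row 11 (bundle F3), seat `pub-ymgap-dag-n06-h` (g4), 2026-08-27.
-/

noncomputable section

namespace Literature.MathematicalPhysics.QuantumFieldTheory.Balaban1983to89.B9Ineq344LocalToKIdx

open Finset Matrix
open B4Reflection242 (boxDom)
open B4TorusKernel.MultiPeriod (torusSupNorm torusSupNorm_nonneg)
open B6MultiLevelBoxOperator (N0 aPrinted)
open B6MultiLevelTorusOperator
open B6Prop22DerivMultiLevelTorus (dT)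
open B6Geom246MultiLevelBox (bset blkOf scale_bounds)
open B6Geom246MultiLevelTorus (bondT connectedT geomT)
open B6Ineq243TwoLevelBox (aNext)
open B6Lemma21Repaired (Ineq261With)
open B6KLevelCensusIndexV1 (KIdx kGeo)
open B6Prop22KLevelTorusCensus (KTIdx)
open B6Prop22KLevelTorusCensusEta (nKT nKT_pos hqTP hqTP_nonneg one_le_torusSupNorm_sub)
open B9Thm314GpFlatMultiLevelTorus (consts_260_261)
open B9Ineq347GpFlatMultiLevelTorus (transfer_rpow)
open B9Ineq346SecondOrderTorusCutoff (cutoffT side cutoffT_nonneg cutoffT_le_one cutoffT_lipschitz one_le_side)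
open B9Ineq344GpAtLetters (Ineq344GpKIdx Ineq345GpKIdx hqTP_add_supF_nonneg two_supF_nonneg hqTP_le_hqTP_add
  residualGpAtOne_letters_of_flat)
open B9Ineq344DualComparisonTorus (CommDatum abs_dGpd_le_dual_majorant abs_dGpd_sub_le_dual_majorant)
open B9Ineq344CutoffDatumTorus
open B9PinMembersKLevelV1 (MemberY geo9Y bg9Y)
open B7Prop2SpecialUnitary (specialUnitaryUnits)
open Node00

variable {d ℓ : ℕ} {hd : 1 ≤ d + 1} {hL : Odd (ℓ + 1) ∧ 1 < ℓ + 1} {b₀ b₁ : ℝ} {Mstar : ℕ}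

/-! ## §1 The schema: local second-order clauses of a comparison pair around each source block -/

section Schema

/-- the radius (in the block distance) of the region on which the comparison pair is local: twice the support radius of a block
cut-off enlarged by one site (`c₀ + 2(d+1)`, FILE 17). [cite: Balaban1984PropagatorsI, (1.118) p.36 (cubes of size 2M₀), dictionary] -/
def rloc (d ℓ : ℕ) : ℕ := 2 * (c0 d ℓ + 2 * (d + 1))

variable (d ℓ hd hL b₀ b₁)

/-- ★ **THE LOCAL SECOND-ORDER CLAUSES OF A COMPARISON PAIR AROUND EACH SOURCE BLOCK** (hypothesis schema; the located residual of
row 11 of the N06 knit): constants `M₁, C₁, C₂(·), C₃(·,·)` such that for every k-level V1 index with `M ≥ M₁`, every block `s′` and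
direction `ν` there are `A^c, G^c, V^c` on the torus with `G^c` symmetric, `G^cA^c = 1`, `A^c = −Δ + V^c` on functions supported
over the blocks of `𝒩_{r_loc}(s′)` with `Σ|V^cu| ≤ C₁L^{−2j′}Σ|u|` there, and for every `λ` supported in `B(s′)`:
(1.110)₃ `|(G^c∂_νᵀλ)(y)| ≤ C₁L^{j′}|λ|` (all `y`); (1.112) `|(∂_κG^c∂_νᵀλ)(y)|, |(∂_κᵀG^c∂_νᵀλ)(y)| ≤ C₂(ε)(‖λ‖_ε + |λ|)`, `0 < ε ≤ 1`,
`y` in a block of `𝒩_{r_loc}(s′)`; (1.113) for `x ≠ x′` of one block of `𝒩_{r_loc}(s′)` (level `j`), `0 < ε ≤ 1`, `0 ≤ β < 1`: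
`|(∂_μG^c∂_νᵀλ)(x′) − (∂_μG^c∂_νᵀλ)(x)| ≤ C₃(ε,β)(|x′−x|_T∕L^j)^β(‖λ‖_{β+ε} + |λ|)` — print's units (`hqTP`, `supF`).  Intended
instance: lit-balaban-p21's charted cube operator `G′(□)` (B4's box operator), for which these are [B5] Prop. 1.2 ∕ [B4] Lemma 2.2.
[cite: Balaban1984PropagatorsI, Prop. 1.2 (1.110), (1.112)–(1.113) p.36, (1.135)–(1.137) pp.39–40; Balaban1983RegularityDecay, Lemma 2.2 (2.17) p.578, (2.34) p.582; Balaban1985BackgroundPropagators, Cor. 3.5 p.407] -/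
def LocalSecondOrderKIdx : Prop :=
  ∃ M₁ C₁ : ℝ, ∃ C₂ : ℝ → ℝ, ∃ C₃ : ℝ → ℝ → ℝ, 0 < M₁ ∧ 0 ≤ C₁ ∧ (∀ ε, 0 ≤ C₂ ε) ∧ (∀ ε β, 0 ≤ C₃ ε β) ∧
    ∀ i : KIdx d ℓ hd hL b₀ b₁, M₁ ≤ (kGeo i).M → ∀ (s' : BlkY i) (ν : Fin (d + 1)),
      ∃ Ac Gc Vc : Matrix (SiteY i) (SiteY i) ℝ, Gc.IsSymm ∧ Gc * Ac = 1 ∧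
        (∀ u : SiteY i → ℝ, (∀ y, blkOf i.D.toDomains y ∉ nbhdT i.D s' (rloc d ℓ) → u y = 0) →
            Ac *ᵥ u = perLapT (toKT i).NB *ᵥ u + Vc *ᵥ u) ∧
        (∀ u : SiteY i → ℝ, (∀ y, blkOf i.D.toDomains y ∉ nbhdT i.D s' (rloc d ℓ) → u y = 0) →
            ∑ y, |(Vc *ᵥ u) y| ≤ C₁ * ((((ℓ : ℝ) + 1) ^ s'.1.1) ^ 2)⁻¹ * ∑ y, |u y|) ∧
        ∀ f : SiteY i → ℝ, (∀ z, f z ≠ 0 → blkOf i.D.toDomains z = s') →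
          (∀ y, |((Gc * (dT (toKT i).NB ν)ᵀ) *ᵥ f) y| ≤ C₁ * ((ℓ : ℝ) + 1) ^ s'.1.1 * (toKT i).supF f) ∧
          (∀ ε : ℝ, 0 < ε → ε ≤ 1 → ∀ (κ' : Fin (d + 1)) (y : SiteY i), blkOf i.D.toDomains y ∈ nbhdT i.D s' (rloc d ℓ) →
              |(dT (toKT i).NB κ' *ᵥ ((Gc * (dT (toKT i).NB ν)ᵀ) *ᵥ f)) y| ≤ C₂ ε * (hqTP (toKT i) ε f + (toKT i).supF f) ∧
              |((dT (toKT i).NB κ')ᵀ *ᵥ ((Gc * (dT (toKT i).NB ν)ᵀ) *ᵥ f)) y| ≤ C₂ ε * (hqTP (toKT i) ε f + (toKT i).supF f)) ∧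
          (∀ ε β : ℝ, 0 < ε → ε ≤ 1 → 0 ≤ β → β < 1 → ∀ (μ : Fin (d + 1)) (x x' : SiteY i),
              blkOf i.D.toDomains x' = blkOf i.D.toDomains x → blkOf i.D.toDomains x ∈ nbhdT i.D s' (rloc d ℓ) → x ≠ x' →
              |(dT (toKT i).NB μ *ᵥ ((Gc * (dT (toKT i).NB ν)ᵀ) *ᵥ f)) x'
                  - (dT (toKT i).NB μ *ᵥ ((Gc * (dT (toKT i).NB ν)ᵀ) *ᵥ f)) x|
                ≤ C₃ ε β * (torusSupNorm (toKT i).NB (x'.1 - x.1) / ((ℓ : ℝ) + 1) ^ (blkOf i.D.toDomains x).1.1) ^ β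
                    * (hqTP (toKT i) (β + ε) f + (toKT i).supF f))

end Schema

/-! ## §2 Arithmetic of the constants; the level window on `𝒩_{r_loc}(s′)`; the (2.60) transfer in the form used -/

section Arithmetic

/-- **THE CONSTANT OF THE COMMUTATOR PAIRING**: with `Φ₀ = C₁L^{j′}S`, `Φ₁ = C₂Q`, `K₁ ≤ 4L∕L^{j′}`, `K₂ ≤ 12L²∕L^{2j′}`, `κ_c = C₁∕L^{2j′}`,
`κ = L²∕L^{2j′}` and `S ≤ Q`: `Θ = Φ₀(3(d+1)K₂ + κ_c + κ) + 2(d+1)K₁Φ₁ ≤ (C₁(37(d+1)L² + C₁) + 8(d+1)L·C₂)·Q∕L^{j′}`.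
[cite: Balaban1984PropagatorsI, (1.128)–(1.131) p.38 (the constants of the walk), bookkeeping] -/
theorem theta_le {C₁ C₂ S Q Lj L K₁ K₂ : ℝ} (dd : ℕ) (hC₁ : 0 ≤ C₁) (hC₂ : 0 ≤ C₂) (hS : 0 ≤ S) (hSQ : S ≤ Q) (hLj : 0 < Lj)
    (hL1 : 1 ≤ L) (hK₁ : K₁ ≤ 4 * L / Lj) (hK₂ : K₂ ≤ 12 * L ^ 2 / Lj ^ 2) :
    C₁ * Lj * S * (3 * ((dd : ℝ) + 1) * K₂ + C₁ * (Lj ^ 2)⁻¹ + L ^ 2 / Lj ^ 2) + 2 * ((dd : ℝ) + 1) * K₁ * (C₂ * Q)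
      ≤ (C₁ * (37 * ((dd : ℝ) + 1) * L ^ 2 + C₁) + 8 * ((dd : ℝ) + 1) * L * C₂) * Q / Lj := by
  have hQ : 0 ≤ Q := hS.trans hSQ
  have hdd : (0 : ℝ) ≤ dd := Nat.cast_nonneg _
  have h1 : C₁ * Lj * S * (3 * ((dd : ℝ) + 1) * K₂ + C₁ * (Lj ^ 2)⁻¹ + L ^ 2 / Lj ^ 2)
      ≤ C₁ * Lj * S * (3 * ((dd : ℝ) + 1) * (12 * L ^ 2 / Lj ^ 2) + C₁ * (Lj ^ 2)⁻¹ + L ^ 2 / Lj ^ 2) := by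
    refine mul_le_mul_of_nonneg_left ?_ (by positivity)
    nlinarith [mul_le_mul_of_nonneg_left hK₂ (by positivity : (0 : ℝ) ≤ 3 * ((dd : ℝ) + 1))]
  have h2 : 2 * ((dd : ℝ) + 1) * K₁ * (C₂ * Q) ≤ 2 * ((dd : ℝ) + 1) * (4 * L / Lj) * (C₂ * Q) := by
    have : 0 ≤ C₂ * Q := mul_nonneg hC₂ hQ
    nlinarith [mul_le_mul_of_nonneg_left hK₁ (by positivity : (0 : ℝ) ≤ 2 * ((dd : ℝ) + 1))]
  refine (add_le_add h1 h2).trans ?_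
  have e : C₁ * Lj * S * (3 * ((dd : ℝ) + 1) * (12 * L ^ 2 / Lj ^ 2) + C₁ * (Lj ^ 2)⁻¹ + L ^ 2 / Lj ^ 2)
      + 2 * ((dd : ℝ) + 1) * (4 * L / Lj) * (C₂ * Q)
      = (C₁ * S * (36 * ((dd : ℝ) + 1) * L ^ 2 + C₁ + L ^ 2) + 8 * ((dd : ℝ) + 1) * L * C₂ * Q) / Lj := by
    field_simp
    ring
  rw [e, div_le_div_iff_of_pos_right hLj]
  have hL2 : L ^ 2 ≤ ((dd : ℝ) + 1) * L ^ 2 := by nlinarith [sq_nonneg L]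
  have h3 : C₁ * S * (36 * ((dd : ℝ) + 1) * L ^ 2 + C₁ + L ^ 2) ≤ C₁ * Q * (37 * ((dd : ℝ) + 1) * L ^ 2 + C₁) := by
    have h4 : 36 * ((dd : ℝ) + 1) * L ^ 2 + C₁ + L ^ 2 ≤ 37 * ((dd : ℝ) + 1) * L ^ 2 + C₁ := by linarith
    calc C₁ * S * (36 * ((dd : ℝ) + 1) * L ^ 2 + C₁ + L ^ 2) ≤ C₁ * S * (37 * ((dd : ℝ) + 1) * L ^ 2 + C₁) :=
          mul_le_mul_of_nonneg_left h4 (mul_nonneg hC₁ hS)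
      _ ≤ C₁ * Q * (37 * ((dd : ℝ) + 1) * L ^ 2 + C₁) :=
          mul_le_mul_of_nonneg_right (mul_le_mul_of_nonneg_left hSQ hC₁) (by positivity)
  nlinarith

/-- the far cut-off's difference bounds dominate by the near ones: `2∕L^{j′} ≤ 4L∕L^{j′}`, `2∕L^{2j′} ≤ 12L²∕L^{2j′}` (`L ≥ 1`).
[cite: Balaban1984PropagatorsI, (1.128) p.38, bookkeeping] -/
theorem far_side_bounds {L Lj : ℝ} (hL1 : 1 ≤ L) (hLj : 0 < Lj) :
    2 / Lj ≤ 4 * L / Lj ∧ 2 / Lj ^ 2 ≤ 12 * L ^ 2 / Lj ^ 2 := by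
  constructor
  · rw [div_le_div_iff_of_pos_right hLj]; linarith
  · rw [div_le_div_iff_of_pos_right (by positivity)]; nlinarith

variable {Mh k R : ℕ} {P : Fin (d + 1) → ℕ} (D : TDomains d ℓ Mh k P R)

/-- **THE LEVEL WINDOW ON `𝒩_{r}(s′)`**: once `r + 1 ≤ R·L·M_h − 1`, a block `t ∈ 𝒩_r(s′)` has level within one of `j′`, hence
`(L^{j(t)})⁻¹ ≤ L∕L^{j′}` and `(L^{2j(t)})⁻¹ ≤ L²∕L^{2j′}`. [cite: Balaban1984PropagatorsII, (2.2) p.224, (2.57) p.233 (level gap)] -/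
theorem pow_window_nbhdT (hMh : 1 ≤ Mh) (hP : ∀ μ, 1 ≤ P μ) {r : ℕ} (hr : r + 1 ≤ R * ((ℓ + 1) * Mh) - 1)
    (s' t : ↥(bset D.toDomains)) (ht : t ∈ nbhdT D s' r) :
    (((ℓ : ℝ) + 1) ^ t.1.1)⁻¹ ≤ ((ℓ : ℝ) + 1) / ((ℓ : ℝ) + 1) ^ s'.1.1 ∧
      ((((ℓ : ℝ) + 1) ^ t.1.1) ^ 2)⁻¹ ≤ ((ℓ : ℝ) + 1) ^ 2 / (((ℓ : ℝ) + 1) ^ s'.1.1) ^ 2 := by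
  have hL0 : (0 : ℝ) < (ℓ : ℝ) + 1 := by positivity
  have hL1 : (1 : ℝ) ≤ (ℓ : ℝ) + 1 := by linarith [(Nat.cast_nonneg ℓ : (0 : ℝ) ≤ ℓ)]
  rw [mem_nbhdT] at ht
  obtain ⟨h1, -⟩ := B9Ineq346SecondOrderTorusCutoff.scale_window_of_distT_le D hMh hP hr s' t ht
  -- `j′ ≤ j(t) + 1` ⇒ `L^{j′} ≤ L·L^{j(t)}`
  have hpow : ((ℓ : ℝ) + 1) ^ s'.1.1 ≤ ((ℓ : ℝ) + 1) * ((ℓ : ℝ) + 1) ^ t.1.1 := by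
    rw [← pow_succ']; exact pow_le_pow_right₀ hL1 h1
  have ht0 : (0 : ℝ) < ((ℓ : ℝ) + 1) ^ t.1.1 := by positivity
  have hs0 : (0 : ℝ) < ((ℓ : ℝ) + 1) ^ s'.1.1 := by positivity
  constructor
  · rw [inv_eq_one_div, div_le_div_iff₀ ht0 hs0]; linarith
  · rw [inv_eq_one_div, div_le_div_iff₀ (by positivity) (by positivity)]
    nlinarith [hpow, ht0.le, hs0.le]

/-- **THE (2.60) TRANSFER IN THE FORM USED**: `L^{j(s)}·e^{−½δ₀d_T(s,s′)} ≤ L·L^{j(s′)}·e^{−⅛δ₀d_T(s,s′)}` once `L ≤ e^{⅜δ₀(R·L·M_h − 1)}`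
(split `½ = ⅜ + ⅛`, `transfer_rpow` with `γ = 1` at rate `½δ₀`). [cite: Balaban1984PropagatorsII, (2.60) p.234; Balaban1985BackgroundPropagators, p.398 (remark after Thm 3.1)] -/
theorem transfer_one (hMh : 1 ≤ Mh) (hP : ∀ μ, 1 ≤ P μ) (hRM : 1 ≤ R * ((ℓ + 1) * Mh)) {δ₀ : ℝ} (hδ₀ : 0 ≤ δ₀)
    (hthr : (ℓ : ℝ) + 1 ≤ Real.exp (3 / 4 * (δ₀ / 2) * ((R : ℝ) * (((ℓ : ℝ) + 1) * Mh) - 1)))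
    (s s' : ↥(bset D.toDomains)) :
    ((ℓ : ℝ) + 1) ^ s.1.1 * Real.exp (-(δ₀ / 2 * (geomT D).dist s s'))
      ≤ ((ℓ : ℝ) + 1) * ((ℓ : ℝ) + 1) ^ s'.1.1 * Real.exp (-(δ₀ / 8 * (geomT D).dist s s')) := by
  have hL0 : (0 : ℝ) < (ℓ : ℝ) + 1 := by positivity
  have ht := transfer_rpow D hMh hP hRM (δ := δ₀ / 2) (by positivity) 1 (by rwa [abs_one, Real.rpow_one]) s' s
  rw [abs_one, Real.rpow_one, one_mul, one_mul, Real.rpow_natCast, Real.rpow_natCast] at ht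
  have hsym : (geomT D).dist s' s = (geomT D).dist s s' := by
    show (((bondT D).dist s' s : ℕ) : ℝ) = (((bondT D).dist s s' : ℕ) : ℝ)
    rw [SimpleGraph.dist_comm]
  rw [hsym] at ht
  have hsplit : Real.exp (-(δ₀ / 2 * (geomT D).dist s s'))
      = Real.exp (-(3 / 4 * (δ₀ / 2) * (geomT D).dist s s')) * Real.exp (-(δ₀ / 8 * (geomT D).dist s s')) := by
    rw [← Real.exp_add]; congr 1; ring
  rw [hsplit, ← mul_assoc]
  refine mul_le_mul_of_nonneg_right ?_ (Real.exp_pos _).le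
  rw [mul_comm]
  exact ht

end Arithmetic

/-! ## §3 The two commutator data at an index -/

section Data

variable {Mh k R : ℕ} {P : Fin (d + 1) → ℕ} (D : TDomains d ℓ Mh k P R)

/-- the support of `χ_{s′}` and of `nearCut s s′` (near case `d_T(s,s′) ≤ c₀ + 2(d+1)`) enlarged by one site lies over `𝒩_{r_loc}(s′)`.
[cite: Balaban1984PropagatorsI, (1.118) p.36, dictionary] -/
theorem nbhd_far_subset (s' : ↥(bset D.toDomains)) : nbhdT D s' (c0 d ℓ + 2 * (d + 1)) ⊆ nbhdT D s' (rloc d ℓ) :=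
  nbhdT_mono D s' (by unfold rloc; omega)

/-- **THE FAR DATUM** at an index: `χ := χ_{s′}` with the schema's locality clauses on `𝒩_{r_loc}(s′)`.
[cite: Balaban1984PropagatorsI, (1.118)–(1.121) pp.36–37; Balaban1984PropagatorsII, (2.13)–(2.14) p.225] -/
theorem commDatum_far (hℓ : 1 ≤ ℓ) (hMh : 3 ≤ Mh) (hR : 2 * (ℓ + 1) ≤ R) (hP4 : ∀ μ, 4 ≤ P μ)
    (hrw : rloc d ℓ + 1 ≤ R * ((ℓ + 1) * Mh) - 1) {a : ℕ → ℝ} (ha0 : ∀ j, 1 ≤ j → 0 ≤ a j) (ha1 : ∀ j, 1 ≤ j → a j ≤ 1)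
    (s' : ↥(bset D.toDomains)) {Ac Vc : Matrix ↥(boxDom (N0 ℓ Mh k P)) ↥(boxDom (N0 ℓ Mh k P)) ℝ} {C₁ : ℝ} (hC₁ : 0 ≤ C₁)
    (hAc : ∀ u : ↥(boxDom (N0 ℓ Mh k P)) → ℝ, (∀ y, blkOf D.toDomains y ∉ nbhdT D s' (rloc d ℓ) → u y = 0) →
      Ac *ᵥ u = perLapT (N0 ℓ Mh k P) *ᵥ u + Vc *ᵥ u)
    (hVc : ∀ u : ↥(boxDom (N0 ℓ Mh k P)) → ℝ, (∀ y, blkOf D.toDomains y ∉ nbhdT D s' (rloc d ℓ) → u y = 0) →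
      ∑ y, |(Vc *ᵥ u) y| ≤ C₁ * ((((ℓ : ℝ) + 1) ^ s'.1.1) ^ 2)⁻¹ * ∑ y, |u y|) :
    CommDatum D a (nbhdT D s' (rloc d ℓ)) (cutoffT D s') Ac Vc (2 / (side D s' : ℝ)) (2 / ((side D s' : ℝ) ^ 2))
      (C₁ * ((((ℓ : ℝ) + 1) ^ s'.1.1) ^ 2)⁻¹) (((ℓ : ℝ) + 1) ^ 2 / (((ℓ : ℝ) + 1) ^ s'.1.1) ^ 2) := by
  have hMh1 : 1 ≤ Mh := le_trans (by norm_num) hMh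
  have hP : ∀ μ, 1 ≤ P μ := fun μ => le_trans (by norm_num) (hP4 μ)
  have hsupp : ∀ u : ↥(boxDom (N0 ℓ Mh k P)) → ℝ, (∀ y, cutoffT D s' y = 0 → u y = 0) →
      ∀ y, blkOf D.toDomains y ∉ nbhdT D s' (rloc d ℓ) → u y = 0 := by
    intro u hu y hy
    refine hu y ?_
    by_contra hc
    have h := mem_nbhdT_of_cutoffT_tshift_ne_zero D hℓ hMh hR hP4 s' y 0 (fun κ => by simp) (by rwa [tshift_zero])
    exact hy (nbhd_far_subset D s' h)
  refine
    { χ_nonneg := cutoffT_nonneg D s'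
      χ_le_one := cutoffT_le_one D s'
      χ_lip := fun μ y => cutoffT_lipschitz D s' hMh1 hP μ y
      χ_second := fun μ y => cutoffT_second_le D s' hℓ hMh hP4 μ y
      χ_near := fun y v hv hy => nbhd_far_subset D s' (mem_nbhdT_of_cutoffT_tshift_ne_zero D hℓ hMh hR hP4 s' y v hv hy)
      Ac_local := fun u hu => hAc u (hsupp u hu)
      Vc_l1 := fun u hu => hVc u (hsupp u hu)
      κc_nonneg := by positivity
      κ_nonneg := by positivity
      a_nonneg := ha0
      κ_bound := fun t ht => ?_ }
  have hj1 : 1 ≤ t.1.1 := (scale_bounds D.toDomains t).1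
  have h2 := (pow_window_nbhdT D hMh1 hP hrw s' t ht).2
  calc a t.1.1 * ((((ℓ : ℝ) + 1) ^ t.1.1) ^ 2)⁻¹ ≤ 1 * ((((ℓ : ℝ) + 1) ^ t.1.1) ^ 2)⁻¹ :=
        mul_le_mul_of_nonneg_right (ha1 t.1.1 hj1) (by positivity)
    _ ≤ _ := by rw [one_mul]; exact h2

/-- **THE NEAR DATUM** at an index (`d_T(s,s′) ≤ c₀ + 2(d+1)`): `χ := 1 − (1 − χ_s)(1 − χ_{s′})`, with the bounds of FILE 17 read through the
level window (`L^{j(s)} ≥ L^{j′}∕L`): `K₁ = 4L∕L^{j′}`, `K₂ = 12L²∕L^{2j′}`.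
[cite: Balaban1984PropagatorsI, (1.118)–(1.121) pp.36–37; Balaban1984PropagatorsII, (2.13)–(2.14) p.225] -/
theorem commDatum_near (hℓ : 1 ≤ ℓ) (hMh : 3 ≤ Mh) (hR : 2 * (ℓ + 1) ≤ R) (hP4 : ∀ μ, 4 ≤ P μ)
    (hrw : rloc d ℓ + 1 ≤ R * ((ℓ + 1) * Mh) - 1) {a : ℕ → ℝ} (ha0 : ∀ j, 1 ≤ j → 0 ≤ a j) (ha1 : ∀ j, 1 ≤ j → a j ≤ 1)
    (s s' : ↥(bset D.toDomains)) (hnear : (bondT D).dist s s' ≤ c0 d ℓ + 2 * (d + 1))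
    {Ac Vc : Matrix ↥(boxDom (N0 ℓ Mh k P)) ↥(boxDom (N0 ℓ Mh k P)) ℝ} {C₁ : ℝ} (hC₁ : 0 ≤ C₁)
    (hAc : ∀ u : ↥(boxDom (N0 ℓ Mh k P)) → ℝ, (∀ y, blkOf D.toDomains y ∉ nbhdT D s' (rloc d ℓ) → u y = 0) →
      Ac *ᵥ u = perLapT (N0 ℓ Mh k P) *ᵥ u + Vc *ᵥ u)
    (hVc : ∀ u : ↥(boxDom (N0 ℓ Mh k P)) → ℝ, (∀ y, blkOf D.toDomains y ∉ nbhdT D s' (rloc d ℓ) → u y = 0) →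
      ∑ y, |(Vc *ᵥ u) y| ≤ C₁ * ((((ℓ : ℝ) + 1) ^ s'.1.1) ^ 2)⁻¹ * ∑ y, |u y|) :
    CommDatum D a (nbhdT D s' (rloc d ℓ)) (nearCut D s s') Ac Vc (4 * ((ℓ : ℝ) + 1) / ((ℓ : ℝ) + 1) ^ s'.1.1)
      (12 * ((ℓ : ℝ) + 1) ^ 2 / (((ℓ : ℝ) + 1) ^ s'.1.1) ^ 2)
      (C₁ * ((((ℓ : ℝ) + 1) ^ s'.1.1) ^ 2)⁻¹) (((ℓ : ℝ) + 1) ^ 2 / (((ℓ : ℝ) + 1) ^ s'.1.1) ^ 2) := by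
  have hMh1 : 1 ≤ Mh := le_trans (by norm_num) hMh
  have hP : ∀ μ, 1 ≤ P μ := fun μ => le_trans (by norm_num) (hP4 μ)
  have hL0 : (0 : ℝ) < (ℓ : ℝ) + 1 := by positivity
  have hL1 : (1 : ℝ) ≤ (ℓ : ℝ) + 1 := by linarith [(Nat.cast_nonneg ℓ : (0 : ℝ) ≤ ℓ)]
  -- the neighbourhood of the near cut-off's support lies over `𝒩_{r_loc}(s′)`
  have hnb : ∀ (y : ↥(boxDom (N0 ℓ Mh k P))) (v : Fin (d + 1) → ℤ), (∀ μ, |v μ| ≤ 1) →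
      nearCut D s s' (tshift (N0 ℓ Mh k P) v y) ≠ 0 → blkOf D.toDomains y ∈ nbhdT D s' (rloc d ℓ) := by
    intro y v hv hy
    have h := mem_nbhdT_of_nearCut_tshift_ne_zero' D hℓ hMh hR hP4 s s' y v hv hy
    exact nbhdT_mono D s' (by unfold rloc; omega) h
  have hsupp : ∀ u : ↥(boxDom (N0 ℓ Mh k P)) → ℝ, (∀ y, nearCut D s s' y = 0 → u y = 0) →
      ∀ y, blkOf D.toDomains y ∉ nbhdT D s' (rloc d ℓ) → u y = 0 := by
    intro u hu y hy
    refine hu y ?_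
    by_contra hc
    exact hy (hnb y 0 (fun κ => by simp) (by rwa [tshift_zero]))
  -- the side lengths through the level window: `L^{j(s)}, L^{j(s′)} ≥ L^{j′}∕L`
  have hs_mem : s ∈ nbhdT D s' (rloc d ℓ) := by rw [mem_nbhdT]; unfold rloc; omega
  have hs'_mem : s' ∈ nbhdT D s' (rloc d ℓ) := by rw [mem_nbhdT, SimpleGraph.dist_self]; exact Nat.zero_le _
  have hws := pow_window_nbhdT D hMh1 hP hrw s' s hs_mem
  have hws' := pow_window_nbhdT D hMh1 hP hrw s' s' hs'_mem
  have hside : ∀ t : ↥(bset D.toDomains), (side D t : ℝ) = ((ℓ : ℝ) + 1) ^ t.1.1 := fun t => by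
    unfold side; push_cast; ring
  have hK₁ : 2 / (side D s : ℝ) + 2 / (side D s' : ℝ) ≤ 4 * ((ℓ : ℝ) + 1) / ((ℓ : ℝ) + 1) ^ s'.1.1 := by
    rw [hside, hside, div_eq_mul_inv, div_eq_mul_inv]
    have h1 := hws.1; have h2 := hws'.1
    calc 2 * (((ℓ : ℝ) + 1) ^ s.1.1)⁻¹ + 2 * (((ℓ : ℝ) + 1) ^ s'.1.1)⁻¹
        ≤ 2 * (((ℓ : ℝ) + 1) / ((ℓ : ℝ) + 1) ^ s'.1.1) + 2 * (((ℓ : ℝ) + 1) / ((ℓ : ℝ) + 1) ^ s'.1.1) := by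
          linarith
      _ = 4 * ((ℓ : ℝ) + 1) / ((ℓ : ℝ) + 1) ^ s'.1.1 := by ring
  have hK₂ : 2 / ((side D s : ℝ) ^ 2) + 2 / ((side D s' : ℝ) ^ 2) + 2 * (2 / (side D s : ℝ)) * (2 / (side D s' : ℝ))
      ≤ 12 * ((ℓ : ℝ) + 1) ^ 2 / (((ℓ : ℝ) + 1) ^ s'.1.1) ^ 2 := by
    rw [hside, hside]
    have h1 := hws.1; have h2 := hws'.1; have h3 := hws.2; have h4 := hws'.2
    have hq : 2 * (2 / ((ℓ : ℝ) + 1) ^ s.1.1) * (2 / ((ℓ : ℝ) + 1) ^ s'.1.1)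
        ≤ 8 * (((ℓ : ℝ) + 1) / ((ℓ : ℝ) + 1) ^ s'.1.1) * (((ℓ : ℝ) + 1) / ((ℓ : ℝ) + 1) ^ s'.1.1) := by
      rw [div_eq_mul_inv (2 : ℝ), div_eq_mul_inv (2 : ℝ)]
      have ha' : 0 ≤ (((ℓ : ℝ) + 1) ^ s.1.1)⁻¹ := by positivity
      have hb' : 0 ≤ (((ℓ : ℝ) + 1) ^ s'.1.1)⁻¹ := by positivity
      nlinarith [mul_le_mul h1 h2 hb' (ha'.trans h1)]
    calc 2 / (((ℓ : ℝ) + 1) ^ s.1.1) ^ 2 + 2 / (((ℓ : ℝ) + 1) ^ s'.1.1) ^ 2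
          + 2 * (2 / ((ℓ : ℝ) + 1) ^ s.1.1) * (2 / ((ℓ : ℝ) + 1) ^ s'.1.1)
        ≤ 2 * (((ℓ : ℝ) + 1) ^ 2 / (((ℓ : ℝ) + 1) ^ s'.1.1) ^ 2) + 2 * (((ℓ : ℝ) + 1) ^ 2 / (((ℓ : ℝ) + 1) ^ s'.1.1) ^ 2)
          + 8 * (((ℓ : ℝ) + 1) / ((ℓ : ℝ) + 1) ^ s'.1.1) * (((ℓ : ℝ) + 1) / ((ℓ : ℝ) + 1) ^ s'.1.1) := by
          rw [div_eq_mul_inv (2 : ℝ) ((((ℓ : ℝ) + 1) ^ s.1.1) ^ 2), div_eq_mul_inv (2 : ℝ) ((((ℓ : ℝ) + 1) ^ s'.1.1) ^ 2)]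
          linarith
      _ = 12 * ((ℓ : ℝ) + 1) ^ 2 / (((ℓ : ℝ) + 1) ^ s'.1.1) ^ 2 := by ring
  refine
    { χ_nonneg := nearCut_nonneg D s s'
      χ_le_one := nearCut_le_one D s s'
      χ_lip := fun μ y => (nearCut_lipschitz D s s' hMh1 hP μ y).trans hK₁
      χ_second := fun μ y => (nearCut_second_le D s s' hℓ hMh hP4 μ y).trans hK₂
      χ_near := hnb
      Ac_local := fun u hu => hAc u (hsupp u hu)
      Vc_l1 := fun u hu => hVc u (hsupp u hu)
      κc_nonneg := by positivity
      κ_nonneg := by positivity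
      a_nonneg := ha0
      κ_bound := fun t ht => ?_ }
  have hj1 : 1 ≤ t.1.1 := (scale_bounds D.toDomains t).1
  have h2 := (pow_window_nbhdT D hMh1 hP hrw s' t ht).2
  calc a t.1.1 * ((((ℓ : ℝ) + 1) ^ t.1.1) ^ 2)⁻¹ ≤ 1 * ((((ℓ : ℝ) + 1) ^ t.1.1) ^ 2)⁻¹ :=
        mul_le_mul_of_nonneg_right (ha1 t.1.1 hj1) (by positivity)
    _ ≤ _ := by rw [one_mul]; exact h2

end Data

/-! ## §4 The assembly: both flat schemas from `LocalSecondOrderKIdx` -/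

section Assembly

variable {Mh k R : ℕ} {P : Fin (d + 1) → ℕ} (D : TDomains d ℓ Mh k P R)

/-- **THE TAIL OF THE REDUCTION'S RIGHT-HAND SIDE**: with `Θ ≤ A·Q∕L^{j′}`, the count `#𝒩_r(s′) ≤ c·e^{⅜δ₀r}` and the transfer
threshold, `Θ·Σ_{t∈𝒩_r(s′)} C·L^{j(s)}·e^{−½δ₀d_T(s,t)} ≤ A·C·c·e^{⅜δ₀r}·e^{½δ₀r}·L·Q·e^{−⅛δ₀d_T(s,s′)}`.
[cite: Balaban1984PropagatorsII, Lemma 2.1 (2.60)–(2.61) p.234, bookkeeping] -/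
theorem tail_le (hMh : 1 ≤ Mh) (hP : ∀ μ, 1 ≤ P μ) (hRM : 1 ≤ R * ((ℓ + 1) * Mh)) {δ₀ C c A Q Θ : ℝ} (hδ₀ : 0 ≤ δ₀)
    (hC : 0 ≤ C) (hc : 0 ≤ c) (hA : 0 ≤ A) (hQ : 0 ≤ Q)
    (hthr : (ℓ : ℝ) + 1 ≤ Real.exp (3 / 4 * (δ₀ / 2) * ((R : ℝ) * (((ℓ : ℝ) + 1) * Mh) - 1)))
    (h261 : Ineq261With c (geomT D) (3 * δ₀ / 2) (1 / 4)) (s s' : ↥(bset D.toDomains)) (r : ℕ)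
    (hΘ : Θ ≤ A * Q / ((ℓ : ℝ) + 1) ^ s'.1.1) :
    Θ * ∑ t ∈ nbhdT D s' r, C * ((ℓ : ℝ) + 1) ^ s.1.1 * Real.exp (-(δ₀ / 2 * (geomT D).dist s t))
      ≤ A * C * (c * Real.exp (1 / 4 * (3 * δ₀ / 2) * r)) * Real.exp (δ₀ / 2 * r) * ((ℓ : ℝ) + 1) * Q
          * Real.exp (-(δ₀ / 8 * (geomT D).dist s s')) := by
  have hL0 : (0 : ℝ) < (ℓ : ℝ) + 1 := by positivity
  have hLj : (0 : ℝ) < ((ℓ : ℝ) + 1) ^ s'.1.1 := by positivity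
  have hcard := card_nbhdT_le D (δ := 3 * δ₀ / 2) (by positivity) h261 s' r
  have hsum := sum_nbhdT_weight_le D hMh hP hδ₀ s s' r
  have htr := transfer_one D hMh hP hRM hδ₀ hthr s s'
  -- the sum
  have h1 : ∑ t ∈ nbhdT D s' r, C * ((ℓ : ℝ) + 1) ^ s.1.1 * Real.exp (-(δ₀ / 2 * (geomT D).dist s t))
      ≤ C * (c * Real.exp (1 / 4 * (3 * δ₀ / 2) * r)) * Real.exp (δ₀ / 2 * r)
          * (((ℓ : ℝ) + 1) ^ s.1.1 * Real.exp (-(δ₀ / 2 * (geomT D).dist s s'))) := by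
    rw [← Finset.mul_sum]
    have hE : 0 ≤ Real.exp (δ₀ / 2 * r) * Real.exp (-(δ₀ / 2 * (geomT D).dist s s')) := by positivity
    calc C * ((ℓ : ℝ) + 1) ^ s.1.1 * ∑ t ∈ nbhdT D s' r, Real.exp (-(δ₀ / 2 * (geomT D).dist s t))
        ≤ C * ((ℓ : ℝ) + 1) ^ s.1.1 * (((nbhdT D s' r).card : ℝ) * Real.exp (δ₀ / 2 * r)
            * Real.exp (-(δ₀ / 2 * (geomT D).dist s s'))) := mul_le_mul_of_nonneg_left hsum (by positivity)
      _ ≤ C * ((ℓ : ℝ) + 1) ^ s.1.1 * ((c * Real.exp (1 / 4 * (3 * δ₀ / 2) * r)) * Real.exp (δ₀ / 2 * r)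
            * Real.exp (-(δ₀ / 2 * (geomT D).dist s s'))) := by
          refine mul_le_mul_of_nonneg_left ?_ (by positivity)
          rw [mul_assoc, mul_assoc]
          exact mul_le_mul_of_nonneg_right hcard hE
      _ = _ := by ring
  -- the transfer
  have h2 : C * (c * Real.exp (1 / 4 * (3 * δ₀ / 2) * r)) * Real.exp (δ₀ / 2 * r)
        * (((ℓ : ℝ) + 1) ^ s.1.1 * Real.exp (-(δ₀ / 2 * (geomT D).dist s s')))
      ≤ C * (c * Real.exp (1 / 4 * (3 * δ₀ / 2) * r)) * Real.exp (δ₀ / 2 * r)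
        * (((ℓ : ℝ) + 1) * ((ℓ : ℝ) + 1) ^ s'.1.1 * Real.exp (-(δ₀ / 8 * (geomT D).dist s s'))) :=
    mul_le_mul_of_nonneg_left htr (by positivity)
  have h3 : Θ * ∑ t ∈ nbhdT D s' r, C * ((ℓ : ℝ) + 1) ^ s.1.1 * Real.exp (-(δ₀ / 2 * (geomT D).dist s t))
      ≤ (A * Q / ((ℓ : ℝ) + 1) ^ s'.1.1) * (C * (c * Real.exp (1 / 4 * (3 * δ₀ / 2) * r)) * Real.exp (δ₀ / 2 * r)
        * (((ℓ : ℝ) + 1) * ((ℓ : ℝ) + 1) ^ s'.1.1 * Real.exp (-(δ₀ / 8 * (geomT D).dist s s')))) :=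
    mul_le_mul hΘ (h1.trans h2) (Finset.sum_nonneg fun _ _ => by positivity) (by positivity)
  refine h3.trans (le_of_eq ?_)
  field_simp

/-- **THE ASSEMBLY OF THE TWO PIECES**: the near term `T ≤ C_ε·Q` (non-zero only in the near case `d_T(s,s′) ≤ c₀ + 2(d+1)`) and the
tail, into `B·e^{−⅛δ₀d_T(s,s′)}·Q` with `B = C_ε e^{⅛δ₀(c₀+2(d+1))} + A·C·c·e^{⅜δ₀r}·e^{½δ₀r}·L`, `r = r_loc`.
[cite: Balaban1984PropagatorsII, Lemma 2.1 (2.60)–(2.61) p.234, bookkeeping] -/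
theorem assemble_le (hMh : 1 ≤ Mh) (hP : ∀ μ, 1 ≤ P μ) (hRM : 1 ≤ R * ((ℓ + 1) * Mh)) {δ₀ C c A Q Θ T Cε : ℝ}
    (hδ₀ : 0 ≤ δ₀) (hC : 0 ≤ C) (hc : 0 ≤ c) (hA : 0 ≤ A) (hQ : 0 ≤ Q) (hCε : 0 ≤ Cε)
    (hthr : (ℓ : ℝ) + 1 ≤ Real.exp (3 / 4 * (δ₀ / 2) * ((R : ℝ) * (((ℓ : ℝ) + 1) * Mh) - 1)))
    (h261 : Ineq261With c (geomT D) (3 * δ₀ / 2) (1 / 4)) (s s' : ↥(bset D.toDomains))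
    (hΘ : Θ ≤ A * Q / ((ℓ : ℝ) + 1) ^ s'.1.1) (hT : T ≤ Cε * Q)
    (hTnear : T ≠ 0 → (bondT D).dist s s' ≤ c0 d ℓ + 2 * (d + 1)) :
    T + Θ * ∑ t ∈ nbhdT D s' (rloc d ℓ), C * ((ℓ : ℝ) + 1) ^ s.1.1 * Real.exp (-(δ₀ / 2 * (geomT D).dist s t))
      ≤ (Cε * Real.exp (δ₀ / 8 * ((c0 d ℓ + 2 * (d + 1) : ℕ) : ℝ))
          + A * C * (c * Real.exp (1 / 4 * (3 * δ₀ / 2) * (rloc d ℓ : ℕ))) * Real.exp (δ₀ / 2 * (rloc d ℓ : ℕ)) * ((ℓ : ℝ) + 1))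
        * Real.exp (-(δ₀ / 8 * (geomT D).dist s s')) * Q := by
  have htail := tail_le D hMh hP hRM hδ₀ hC hc hA hQ hthr h261 s s' (rloc d ℓ) hΘ
  have hdist : (geomT D).dist s s' = (((bondT D).dist s s' : ℕ) : ℝ) := rfl
  have hT' : T ≤ Cε * Real.exp (δ₀ / 8 * ((c0 d ℓ + 2 * (d + 1) : ℕ) : ℝ)) * Real.exp (-(δ₀ / 8 * (geomT D).dist s s')) * Q := by
    by_cases hT0 : T = 0
    · rw [hT0]
      exact mul_nonneg (mul_nonneg (mul_nonneg hCε (Real.exp_pos _).le) (Real.exp_pos _).le) hQ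
    · have hnear : (((bondT D).dist s s' : ℕ) : ℝ) ≤ ((c0 d ℓ + 2 * (d + 1) : ℕ) : ℝ) := by exact_mod_cast hTnear hT0
      have hexp : 1 ≤ Real.exp (δ₀ / 8 * ((c0 d ℓ + 2 * (d + 1) : ℕ) : ℝ)) * Real.exp (-(δ₀ / 8 * (geomT D).dist s s')) := by
        rw [← Real.exp_add, hdist]
        refine Real.one_le_exp_iff.2 ?_
        nlinarith
      calc T ≤ Cε * Q := hT
        _ = Cε * 1 * Q := by ring
        _ ≤ Cε * (Real.exp (δ₀ / 8 * ((c0 d ℓ + 2 * (d + 1) : ℕ) : ℝ)) * Real.exp (-(δ₀ / 8 * (geomT D).dist s s'))) * Q :=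
            mul_le_mul_of_nonneg_right (mul_le_mul_of_nonneg_left hexp hCε) hQ
        _ = _ := by ring
  refine (add_le_add hT' htail).trans (le_of_eq ?_)
  ring

end Assembly

section Main

/-- ★★ **(3.44) AT U = 1, FLAT FORM (`Ineq344GpKIdx`), FROM THE LOCAL SECOND-ORDER CLAUSES.**  At every k-level V1 index above a threshold:
for `x ∈ B(s)`, `λ` in `B(s′)`, the dual comparison with the far datum (`d_T(s,s′) > c₀ + 2(d+1)`, `c = 0`) or the near datum
(`c = 1`, the near term being the (1.112)-clause at `x`), the pairing constant `Θ ≤ A(ε)(‖λ‖_ε + |λ|)∕L^{j′}`, the (2.61) count of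
`𝒩_{r_loc}(s′)` and the (2.60) transfer `L^{j(s)} ↦ L·L^{j′}` at the cost of `⅜δ₀`.
[cite: Balaban1985BackgroundPropagators, Thm 3.1 (3.44) p.398 + Cor. 3.5 p.407; Balaban1984PropagatorsII, Prop. 2.2 (2.67), Lemma 2.1 (2.60)–(2.61) p.234; Balaban1984PropagatorsI, Prop. 1.2 (1.110), (1.112) p.36] -/
theorem ineq344GpKIdx_of_local (hloc : LocalSecondOrderKIdx d ℓ hd hL b₀ b₁) : Ineq344GpKIdx d ℓ hd hL b₀ b₁ := by
  obtain ⟨M₁, C₁, C₂, C₃, hM₁, hC₁, hC₂, -, H⟩ := hloc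
  by_cases hℓ : 1 ≤ ℓ
  swap
  · exact ⟨1, 1, fun _ => 0, one_pos, one_pos, fun _ => le_rfl, fun i => absurd (le_trans (by norm_num) i.hℓ) hℓ⟩
  have hL0 : (0 : ℝ) < (ℓ : ℝ) + 1 := by positivity
  have hL1 : (1 : ℝ) ≤ (ℓ : ℝ) + 1 := by linarith [(Nat.cast_nonneg ℓ : (0 : ℝ) ≤ ℓ)]
  have hL2 : (1 : ℝ) < ((ℓ : ℝ) + 1) ^ 2 := by
    have h1 : (1 : ℝ) ≤ ℓ := by exact_mod_cast hℓ
    nlinarith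
  have hamin : 0 < 1 - ((((ℓ : ℝ) + 1)) ^ 2)⁻¹ := by rw [sub_pos]; exact inv_lt_one_of_one_lt₀ hL2
  obtain ⟨hwin, hrec⟩ := B6Prop22KLevelCensus.KIdx.aPrinted_windows hℓ
  have ha0 : ∀ j, 1 ≤ j → 0 ≤ aPrinted ℓ 1 j := fun j hj => hamin.le.trans (hwin j hj).1
  have ha1 : ∀ j, 1 ≤ j → aPrinted ℓ 1 j ≤ 1 := fun j hj => (hwin j hj).2
  -- lit-balaban-p21 through the dual comparison (FILE 16)
  obtain ⟨δ₀, C, M₀, N₀, hδ₀, hC, hM₀, hN₀, Hmaj⟩ :=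
    abs_dGpd_le_dual_majorant d ℓ hℓ (1 - ((((ℓ : ℝ) + 1)) ^ 2)⁻¹) 1 1 1 hamin one_pos
  -- (2.60)/(2.61) at the rate `3δ₀/2`
  obtain ⟨N₂, c261, hN₂, hc261, H261⟩ := consts_260_261 d ℓ (δ := 3 * δ₀ / 2) (by positivity)
  -- the constants
  obtain ⟨A, hA⟩ : ∃ A : ℝ → ℝ, ∀ ε, A ε = C₁ * (37 * ((d : ℝ) + 1) * ((ℓ : ℝ) + 1) ^ 2 + C₁) + 8 * ((d : ℝ) + 1) * ((ℓ : ℝ) + 1) * C₂ ε :=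
    ⟨fun ε => _, fun ε => rfl⟩
  have hA0 : ∀ ε, 0 ≤ A ε := fun ε => by rw [hA]; have := hC₂ ε; positivity
  obtain ⟨Bc, hBc⟩ : ∃ Bc : ℝ → ℝ, ∀ ε, Bc ε = C₂ ε * Real.exp (δ₀ / 8 * ((c0 d ℓ + 2 * (d + 1) : ℕ) : ℝ))
      + A ε * C * (c261 * Real.exp (1 / 4 * (3 * δ₀ / 2) * (rloc d ℓ : ℕ))) * Real.exp (δ₀ / 2 * (rloc d ℓ : ℕ))
        * ((ℓ : ℝ) + 1) := ⟨fun ε => _, fun ε => rfl⟩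
  have hBc0 : ∀ ε, 0 ≤ Bc ε := fun ε => by rw [hBc]; have := hC₂ ε; have := hA0 ε; positivity
  -- the threshold
  refine ⟨max (max M₁ M₀) ((((max (max N₀ N₂) (rloc d ℓ + 2) : ℕ) : ℝ)) + 1), δ₀ / 8, Bc,
    lt_max_of_lt_left (lt_max_of_lt_left hM₁), by positivity, hBc0, ?_⟩
  intro i hM ε hε hε1 s s' f hsupp μ ν x hx
  -- index facts
  have hLcast : (((ℓ + 1 : ℕ) : ℝ)) = (ℓ : ℝ) + 1 := by push_cast; ring
  have hMdef : (kGeo i).M = (((ℓ + 1 : ℕ) : ℝ)) * (i.Mh : ℝ) := rfl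
  have hM' : max (max M₁ M₀) ((((max (max N₀ N₂) (rloc d ℓ + 2) : ℕ) : ℝ)) + 1) ≤ ((ℓ : ℝ) + 1) * i.Mh := by
    rw [hMdef, hLcast] at hM; exact hM
  have hM₁i : M₁ ≤ (kGeo i).M := le_trans ((le_max_left _ _).trans (le_max_left _ _)) hM
  have hM₀' : M₀ ≤ ((ℓ : ℝ) + 1) * i.Mh := le_trans ((le_max_right _ _).trans (le_max_left _ _)) hM'
  have hMh3 : 3 ≤ i.Mh := le_trans (by norm_num) i.hM8
  have hMh1 : 1 ≤ i.Mh := le_trans (by norm_num) hMh3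
  have hPi : ∀ μ, 1 ≤ i.P' μ := (toKT i).hP
  have hP4 : ∀ μ, 4 ≤ i.P' μ := (toKT i).hP4
  have hRi : 2 * (ℓ + 1) ≤ i.R := (toKT i).hR
  have hR1 : 1 ≤ i.R := le_trans (by omega) hRi
  have hNat : max (max N₀ N₂) (rloc d ℓ + 2) + 1 ≤ (ℓ + 1) * i.Mh := by
    have h1 : ((((max (max N₀ N₂) (rloc d ℓ + 2) : ℕ) : ℝ)) + 1) ≤ ((ℓ : ℝ) + 1) * i.Mh := (le_max_right _ _).trans hM'
    exact_mod_cast h1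
  have hRLM : (ℓ + 1) * i.Mh ≤ i.R * ((ℓ + 1) * i.Mh) := by
    calc (ℓ + 1) * i.Mh = 1 * ((ℓ + 1) * i.Mh) := (one_mul _).symm
      _ ≤ i.R * ((ℓ + 1) * i.Mh) := Nat.mul_le_mul_right _ hR1
  have hRN₀ : N₀ + 1 ≤ i.R * ((ℓ + 1) * i.Mh) := by
    have := le_max_left N₀ N₂; have := le_max_left (max N₀ N₂) (rloc d ℓ + 2); omega
  have hRN₂ : N₂ + 1 ≤ i.R * ((ℓ + 1) * i.Mh) := by
    have := le_max_right N₀ N₂; have := le_max_left (max N₀ N₂) (rloc d ℓ + 2); omega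
  have hrw : rloc d ℓ + 1 ≤ i.R * ((ℓ + 1) * i.Mh) - 1 := by
    have := le_max_right (max N₀ N₂) (rloc d ℓ + 2); omega
  have hRM1 : 1 ≤ i.R * ((ℓ + 1) * i.Mh) := by omega
  -- the local pair at `(s′, ν)`
  obtain ⟨Ac, Gc, Vc, hGc, hGcAc, hAcl, hVcl, Hf⟩ := H i hM₁i s' ν
  obtain ⟨hΦ₀c, hΦ₁c, -⟩ := Hf f hsupp
  -- (2.60)/(2.61) at this torus
  obtain ⟨hthr2, h261⟩ := H261 i.k i.Mh i.R i.P' hMh1 hPi hRN₂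
  have h261D := h261 i.D
  have hthr : (ℓ : ℝ) + 1 ≤ Real.exp (3 / 4 * (δ₀ / 2) * ((i.R : ℝ) * (((ℓ : ℝ) + 1) * i.Mh) - 1)) := by
    have e : 3 / 4 * (δ₀ / 2) = 1 / 4 * (3 * δ₀ / 2) := by ring
    rw [e]
    exact le_trans (by nlinarith) hthr2
  -- the norms
  have hS0 : 0 ≤ (toKT i).supF f := by linarith [two_supF_nonneg (toKT i) f]
  have hQ0 : 0 ≤ hqTP (toKT i) ε f + (toKT i).supF f := hqTP_add_supF_nonneg (toKT i) ε f
  have hSQ : (toKT i).supF f ≤ hqTP (toKT i) ε f + (toKT i).supF f := by linarith [hqTP_nonneg (toKT i) ε f]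
  have hLj : (0 : ℝ) < ((ℓ : ℝ) + 1) ^ s'.1.1 := by positivity
  have hΦ₀0 : 0 ≤ C₁ * ((ℓ : ℝ) + 1) ^ s'.1.1 * (toKT i).supF f := by positivity
  have hΦ₁0 : 0 ≤ C₂ ε * (hqTP (toKT i) ε f + (toKT i).supF f) := mul_nonneg (hC₂ ε) hQ0
  have hΦ₁ : ∀ (κ' : Fin (d + 1)) (y : SiteY i), blkOf i.D.toDomains y ∈ nbhdT i.D s' (rloc d ℓ) →
      |(dT (toKT i).NB κ' *ᵥ ((Gc * (dT (toKT i).NB ν)ᵀ) *ᵥ f)) y| ≤ C₂ ε * (hqTP (toKT i) ε f + (toKT i).supF f) ∧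
      |((dT (toKT i).NB κ')ᵀ *ᵥ ((Gc * (dT (toKT i).NB ν)ᵀ) *ᵥ f)) y| ≤ C₂ ε * (hqTP (toKT i) ε f + (toKT i).supF f) :=
    fun κ' y hy => hΦ₁c ε hε hε1 κ' y hy
  -- the distance and its sign
  have hd0 : 0 ≤ (geomT i.D).dist s s' := by exact Nat.cast_nonneg _
  -- the side lengths of the cut-offs through the level window (far case uses `s′` only)
  have hsides' : (side i.D s' : ℝ) = ((ℓ : ℝ) + 1) ^ s'.1.1 := by unfold side; push_cast; ring
  have hK₁far : 2 / (side i.D s' : ℝ) ≤ 4 * ((ℓ : ℝ) + 1) / ((ℓ : ℝ) + 1) ^ s'.1.1 := by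
    rw [hsides']; exact (far_side_bounds hL1 hLj).1
  have hK₂far : 2 / ((side i.D s' : ℝ) ^ 2) ≤ 12 * ((ℓ : ℝ) + 1) ^ 2 / (((ℓ : ℝ) + 1) ^ s'.1.1) ^ 2 := by
    rw [hsides']; exact (far_side_bounds hL1 hLj).2
  -- the common bound of `Θ`
  have hΘ : ∀ {K₁ K₂ : ℝ}, K₁ ≤ 4 * ((ℓ : ℝ) + 1) / ((ℓ : ℝ) + 1) ^ s'.1.1 →
      K₂ ≤ 12 * ((ℓ : ℝ) + 1) ^ 2 / (((ℓ : ℝ) + 1) ^ s'.1.1) ^ 2 →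
      C₁ * ((ℓ : ℝ) + 1) ^ s'.1.1 * (toKT i).supF f * (3 * ((d : ℝ) + 1) * K₂ + C₁ * ((((ℓ : ℝ) + 1) ^ s'.1.1) ^ 2)⁻¹
          + ((ℓ : ℝ) + 1) ^ 2 / (((ℓ : ℝ) + 1) ^ s'.1.1) ^ 2)
        + 2 * ((d : ℝ) + 1) * K₁ * (C₂ ε * (hqTP (toKT i) ε f + (toKT i).supF f))
        ≤ A ε * (hqTP (toKT i) ε f + (toKT i).supF f) / ((ℓ : ℝ) + 1) ^ s'.1.1 := by
    intro K₁ K₂ hK₁ hK₂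
    rw [hA]
    exact theta_le (C₁ := C₁) (C₂ := C₂ ε) (S := (toKT i).supF f) (Q := hqTP (toKT i) ε f + (toKT i).supF f)
      (Lj := ((ℓ : ℝ) + 1) ^ s'.1.1) (L := (ℓ : ℝ) + 1) d hC₁ (hC₂ ε) hS0 hSQ hLj hL1 hK₁ hK₂
  -- the final form of the right-hand side from the two pieces
  have hfinal : ∀ {T Θ : ℝ}, T ≤ C₂ ε * (hqTP (toKT i) ε f + (toKT i).supF f) →
      (T ≠ 0 → (bondT i.D).dist s s' ≤ c0 d ℓ + 2 * (d + 1)) →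
      Θ ≤ A ε * (hqTP (toKT i) ε f + (toKT i).supF f) / ((ℓ : ℝ) + 1) ^ s'.1.1 →
      T + Θ * ∑ t ∈ nbhdT i.D s' (rloc d ℓ), C * ((ℓ : ℝ) + 1) ^ s.1.1 * Real.exp (-(δ₀ / 2 * (geomT i.D).dist s t))
        ≤ Bc ε * Real.exp (-(δ₀ / 8 * (geomT i.D).dist s s')) * (hqTP (toKT i) ε f + (toKT i).supF f) := by
    intro T Θ hT hTnear hΘA
    rw [hBc]
    exact assemble_le i.D hMh1 hPi hRM1 hδ₀.le hC.le hc261 (hA0 ε) hQ0 (hC₂ ε) hthr h261D s s' hΘA hT hTnear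
  -- the two cases
  by_cases hfar : c0 d ℓ + 2 * (d + 1) < (bondT i.D).dist s s'
  · -- FAR: `χ = χ_{s′}`, `c = 0`
    have hcd := commDatum_far i.D hℓ hMh3 hRi hP4 hrw ha0 ha1 s' hC₁ hAcl hVcl
    have hst := cutoffT_far_stencil i.D s s' hℓ hMh3 hRi hP4 μ hx hfar
    have hpl := cutoffT_plateau_supp i.D s' hMh1 hPi ν f hsupp
    have hmain := Hmaj i.k i.Mh i.R hMh3 hM₀' hRi hRN₀ i.P' hPi hP4 i.D (aPrinted ℓ 1) (fun _ => 1) hwin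
      (fun j _ => ⟨le_rfl, le_rfl⟩) hrec (nbhdT i.D s' (rloc d ℓ)) (cutoffT i.D s') Ac Gc Vc _ _ _ _ hGc hGcAc hcd μ ν f x 0
      hpl hst _ _ hΦ₀0 hΦ₀c hΦ₁0 hΦ₁
    rw [hx, abs_zero, zero_mul] at hmain
    exact hmain.trans (hfinal (mul_nonneg (hC₂ ε) hQ0) (fun h => absurd rfl h) (hΘ hK₁far hK₂far))
  · -- NEAR: `χ = 1 − (1 − χ_s)(1 − χ_{s′})`, `c = 1`
    push Not at hfar
    have hcd := commDatum_near i.D hℓ hMh3 hRi hP4 hrw ha0 ha1 s s' hfar hC₁ hAcl hVcl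
    have hst := nearCut_near_stencil i.D s s' hMh1 hPi μ hx
    have hpl := nearCut_plateau_supp i.D s s' hMh1 hPi ν f hsupp
    have hmain := Hmaj i.k i.Mh i.R hMh3 hM₀' hRi hRN₀ i.P' hPi hP4 i.D (aPrinted ℓ 1) (fun _ => 1) hwin
      (fun j _ => ⟨le_rfl, le_rfl⟩) hrec (nbhdT i.D s' (rloc d ℓ)) (nearCut i.D s s') Ac Gc Vc _ _ _ _ hGc hGcAc hcd μ ν f x 1
      hpl hst _ _ hΦ₀0 hΦ₀c hΦ₁0 hΦ₁
    rw [hx, abs_one, one_mul] at hmain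
    -- the near term is the (1.112)-clause at `x`
    have hs_mem : s ∈ nbhdT i.D s' (rloc d ℓ) := by rw [mem_nbhdT]; unfold rloc; omega
    have hT : |((dT (toKT i).NB μ * Gc * (dT (toKT i).NB ν)ᵀ) *ᵥ f) x| ≤ C₂ ε * (hqTP (toKT i) ε f + (toKT i).supF f) := by
      rw [Matrix.mul_assoc, ← Matrix.mulVec_mulVec]
      exact (hΦ₁ μ x (by rw [hx]; exact hs_mem)).1
    exact hmain.trans (hfinal hT (fun _ => hfar) (hΘ le_rfl le_rfl))


/-- ★★ **(3.45) AT U = 1, FLAT ONE-BLOCK-PAIR FORM (`Ineq345GpKIdx`), FROM THE LOCAL SECOND-ORDER CLAUSES.**  As `ineq344GpKIdx_of_local`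
with p21's Hölder member (FILE 16's `abs_dGpd_sub_le_dual_majorant`, `α = β`): the near term is the (1.113)-clause for the pair
`x, x′ ∈ B(s)`, the tail carries `|x′−x|_T^β(L^{j(s)})^{1−β} = (|x′−x|_T∕L^{j(s)})^β·L^{j(s)}`, and `‖λ‖_ε ≤ ‖λ‖_{β+ε} + 2|λ|` converts the
(1.112)-data to the printed norm. [cite: Balaban1985BackgroundPropagators, Thm 3.1 (3.45) p.398 + Cor. 3.5 p.407; Balaban1984PropagatorsII, Prop. 2.2 (2.67) p.234 (fourth entry), Lemma 2.1 (2.60)–(2.61) p.234; Balaban1984PropagatorsI, Prop. 1.2 (1.112)–(1.113) p.36] -/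
theorem ineq345GpKIdx_of_local (hloc : LocalSecondOrderKIdx d ℓ hd hL b₀ b₁) : Ineq345GpKIdx d ℓ hd hL b₀ b₁ := by
  obtain ⟨M₁, C₁, C₂, C₃, hM₁, hC₁, hC₂, hC₃, H⟩ := hloc
  by_cases hℓ : 1 ≤ ℓ
  swap
  · exact ⟨1, 1, fun _ _ => 0, one_pos, one_pos, fun _ _ => le_rfl, fun i => absurd (le_trans (by norm_num) i.hℓ) hℓ⟩
  have hL0 : (0 : ℝ) < (ℓ : ℝ) + 1 := by positivity
  have hL1 : (1 : ℝ) ≤ (ℓ : ℝ) + 1 := by linarith [(Nat.cast_nonneg ℓ : (0 : ℝ) ≤ ℓ)]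
  have hL2 : (1 : ℝ) < ((ℓ : ℝ) + 1) ^ 2 := by
    have h1 : (1 : ℝ) ≤ ℓ := by exact_mod_cast hℓ
    nlinarith
  have hamin : 0 < 1 - ((((ℓ : ℝ) + 1)) ^ 2)⁻¹ := by rw [sub_pos]; exact inv_lt_one_of_one_lt₀ hL2
  obtain ⟨hwin, hrec⟩ := B6Prop22KLevelCensus.KIdx.aPrinted_windows hℓ
  have ha0 : ∀ j, 1 ≤ j → 0 ≤ aPrinted ℓ 1 j := fun j hj => hamin.le.trans (hwin j hj).1
  have ha1 : ∀ j, 1 ≤ j → aPrinted ℓ 1 j ≤ 1 := fun j hj => (hwin j hj).2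
  -- lit-balaban-p21's Hölder member through the dual comparison (FILE 16)
  obtain ⟨δ₀, M₀, N₀, hδ₀, hM₀, hN₀, H45⟩ :=
    abs_dGpd_sub_le_dual_majorant d ℓ hℓ (1 - ((((ℓ : ℝ) + 1)) ^ 2)⁻¹) 1 1 1 hamin one_pos
  -- the `β`-dependent constant (choice)
  obtain ⟨Cf, hCf⟩ : ∃ Cf : ℝ → ℝ, ∀ β, Cf β = if h : 0 ≤ β ∧ β < 1 then Classical.choose (H45 β h.1 h.2) else 1 :=
    ⟨fun β => _, fun β => rfl⟩
  have hCf_pos : ∀ β, 0 < Cf β := fun β => by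
    rw [hCf]; split_ifs with h
    · exact (Classical.choose_spec (H45 β h.1 h.2)).1
    · exact one_pos
  -- (2.60)/(2.61) at the rate `3δ₀/2`
  obtain ⟨N₂, c261, hN₂, hc261, H261⟩ := consts_260_261 d ℓ (δ := 3 * δ₀ / 2) (by positivity)
  -- the constants (`Q′ = ‖λ‖_{β+ε} + |λ|`; the (1.112)-data enter with `‖λ‖_ε + |λ| ≤ 3Q′`)
  obtain ⟨A, hA⟩ : ∃ A : ℝ → ℝ, ∀ ε, A ε = 3 * (C₁ * (37 * ((d : ℝ) + 1) * ((ℓ : ℝ) + 1) ^ 2 + C₁)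
      + 8 * ((d : ℝ) + 1) * ((ℓ : ℝ) + 1) * C₂ ε) := ⟨fun ε => _, fun ε => rfl⟩
  have hA0 : ∀ ε, 0 ≤ A ε := fun ε => by rw [hA]; have := hC₂ ε; positivity
  obtain ⟨Bc, hBc⟩ : ∃ Bc : ℝ → ℝ → ℝ, ∀ ε β, Bc ε β = C₃ ε β * Real.exp (δ₀ / 8 * ((c0 d ℓ + 2 * (d + 1) : ℕ) : ℝ))
      + A ε * Cf β * (c261 * Real.exp (1 / 4 * (3 * δ₀ / 2) * (rloc d ℓ : ℕ))) * Real.exp (δ₀ / 2 * (rloc d ℓ : ℕ))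
        * ((ℓ : ℝ) + 1) := ⟨fun ε β => _, fun ε β => rfl⟩
  have hBc0 : ∀ ε β, 0 ≤ Bc ε β := fun ε β => by
    rw [hBc]; have := hC₃ ε β; have := hA0 ε; have := (hCf_pos β).le; positivity
  refine ⟨max (max M₁ M₀) ((((max (max N₀ N₂) (rloc d ℓ + 2) : ℕ) : ℝ)) + 1), δ₀ / 8, Bc,
    lt_max_of_lt_left (lt_max_of_lt_left hM₁), by positivity, hBc0, ?_⟩
  intro i hM ε β hε hε1 hβ0 hβ1 s s' f hsupp μ ν x x' hx hx' hne
  -- index facts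
  have hLcast : (((ℓ + 1 : ℕ) : ℝ)) = (ℓ : ℝ) + 1 := by push_cast; ring
  have hMdef : (kGeo i).M = (((ℓ + 1 : ℕ) : ℝ)) * (i.Mh : ℝ) := rfl
  have hM' : max (max M₁ M₀) ((((max (max N₀ N₂) (rloc d ℓ + 2) : ℕ) : ℝ)) + 1) ≤ ((ℓ : ℝ) + 1) * i.Mh := by
    rw [hMdef, hLcast] at hM; exact hM
  have hM₁i : M₁ ≤ (kGeo i).M := le_trans ((le_max_left _ _).trans (le_max_left _ _)) hM
  have hM₀' : M₀ ≤ ((ℓ : ℝ) + 1) * i.Mh := le_trans ((le_max_right _ _).trans (le_max_left _ _)) hM'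
  have hMh3 : 3 ≤ i.Mh := le_trans (by norm_num) i.hM8
  have hMh1 : 1 ≤ i.Mh := le_trans (by norm_num) hMh3
  have hPi : ∀ μ, 1 ≤ i.P' μ := (toKT i).hP
  have hP4 : ∀ μ, 4 ≤ i.P' μ := (toKT i).hP4
  have hRi : 2 * (ℓ + 1) ≤ i.R := (toKT i).hR
  have hR1 : 1 ≤ i.R := le_trans (by omega) hRi
  have hNat : max (max N₀ N₂) (rloc d ℓ + 2) + 1 ≤ (ℓ + 1) * i.Mh := by
    have h1 : ((((max (max N₀ N₂) (rloc d ℓ + 2) : ℕ) : ℝ)) + 1) ≤ ((ℓ : ℝ) + 1) * i.Mh := (le_max_right _ _).trans hM'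
    exact_mod_cast h1
  have hRLM : (ℓ + 1) * i.Mh ≤ i.R * ((ℓ + 1) * i.Mh) := by
    calc (ℓ + 1) * i.Mh = 1 * ((ℓ + 1) * i.Mh) := (one_mul _).symm
      _ ≤ i.R * ((ℓ + 1) * i.Mh) := Nat.mul_le_mul_right _ hR1
  have hRN₀ : N₀ + 1 ≤ i.R * ((ℓ + 1) * i.Mh) := by
    have := le_max_left N₀ N₂; have := le_max_left (max N₀ N₂) (rloc d ℓ + 2); omega
  have hRN₂ : N₂ + 1 ≤ i.R * ((ℓ + 1) * i.Mh) := by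
    have := le_max_right N₀ N₂; have := le_max_left (max N₀ N₂) (rloc d ℓ + 2); omega
  have hrw : rloc d ℓ + 1 ≤ i.R * ((ℓ + 1) * i.Mh) - 1 := by
    have := le_max_right (max N₀ N₂) (rloc d ℓ + 2); omega
  have hRM1 : 1 ≤ i.R * ((ℓ + 1) * i.Mh) := by omega
  -- the `β`-constant of the Hölder member (the chosen one)
  have Hch := Classical.choose_spec (H45 β hβ0 hβ1)
  set Cβ := Classical.choose (H45 β hβ0 hβ1) with hCβdef
  have hCfβ : Cf β = Cβ := by rw [hCf, dif_pos ⟨hβ0, hβ1⟩]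
  obtain ⟨hCβ, HmajC⟩ := Hch
  -- the local pair at `(s′, ν)`
  obtain ⟨Ac, Gc, Vc, hGc, hGcAc, hAcl, hVcl, Hf⟩ := H i hM₁i s' ν
  obtain ⟨hΦ₀c, hΦ₁c, hΦ₂c⟩ := Hf f hsupp
  -- (2.60)/(2.61) at this torus
  obtain ⟨hthr2, h261⟩ := H261 i.k i.Mh i.R i.P' hMh1 hPi hRN₂
  have h261D := h261 i.D
  have hthr : (ℓ : ℝ) + 1 ≤ Real.exp (3 / 4 * (δ₀ / 2) * ((i.R : ℝ) * (((ℓ : ℝ) + 1) * i.Mh) - 1)) := by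
    have e : 3 / 4 * (δ₀ / 2) = 1 / 4 * (3 * δ₀ / 2) := by ring
    rw [e]
    exact le_trans (by nlinarith) hthr2
  -- the norms: `Q = ‖λ‖_ε + |λ| ≤ 3Q′`, `Q′ = ‖λ‖_{β+ε} + |λ|`
  have hS0 : 0 ≤ (toKT i).supF f := by linarith [two_supF_nonneg (toKT i) f]
  have hQ0 : 0 ≤ hqTP (toKT i) ε f + (toKT i).supF f := hqTP_add_supF_nonneg (toKT i) ε f
  have hQ'0 : 0 ≤ hqTP (toKT i) (β + ε) f + (toKT i).supF f := hqTP_add_supF_nonneg (toKT i) (β + ε) f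
  have hSQ : (toKT i).supF f ≤ hqTP (toKT i) ε f + (toKT i).supF f := by linarith [hqTP_nonneg (toKT i) ε f]
  have hQQ' : hqTP (toKT i) ε f + (toKT i).supF f ≤ 3 * (hqTP (toKT i) (β + ε) f + (toKT i).supF f) := by
    have := hqTP_le_hqTP_add (toKT i) hε hβ0 f
    have := hqTP_nonneg (toKT i) (β + ε) f
    linarith
  have hLj : (0 : ℝ) < ((ℓ : ℝ) + 1) ^ s'.1.1 := by positivity
  have hLjs : (0 : ℝ) < ((ℓ : ℝ) + 1) ^ s.1.1 := by positivity
  have hΦ₀0 : 0 ≤ C₁ * ((ℓ : ℝ) + 1) ^ s'.1.1 * (toKT i).supF f := by positivity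
  have hΦ₁0 : 0 ≤ C₂ ε * (hqTP (toKT i) ε f + (toKT i).supF f) := mul_nonneg (hC₂ ε) hQ0
  have hΦ₁ : ∀ (κ' : Fin (d + 1)) (y : SiteY i), blkOf i.D.toDomains y ∈ nbhdT i.D s' (rloc d ℓ) →
      |(dT (toKT i).NB κ' *ᵥ ((Gc * (dT (toKT i).NB ν)ᵀ) *ᵥ f)) y| ≤ C₂ ε * (hqTP (toKT i) ε f + (toKT i).supF f) ∧
      |((dT (toKT i).NB κ')ᵀ *ᵥ ((Gc * (dT (toKT i).NB ν)ᵀ) *ᵥ f)) y| ≤ C₂ ε * (hqTP (toKT i) ε f + (toKT i).supF f) :=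
    fun κ' y hy => hΦ₁c ε hε hε1 κ' y hy
  have hne' : x'.1 ≠ x.1 := fun h => hne (Subtype.ext h.symm)
  have hblk : blkOf i.D.toDomains x' = blkOf i.D.toDomains x := by rw [hx, hx']
  -- the pair weight `w = (|x′−x|_T/L^{j(s)})^β` and the Hölder tail rewritten
  have htpos : 0 < torusSupNorm (toKT i).NB (x'.1 - x.1) := lt_of_lt_of_le one_pos (one_le_torusSupNorm_sub (toKT i) hne')
  set w : ℝ := (torusSupNorm (toKT i).NB (x'.1 - x.1) / ((ℓ : ℝ) + 1) ^ s.1.1) ^ β with hw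
  have hw0 : 0 < w := Real.rpow_pos_of_pos (div_pos htpos hLjs) _
  have hlevx : i.D.lev x.1 = s.1.1 := by rw [B9Ineq346SecondOrderTorusCore.lev_eq_scale i.D x, hx]
  have htail_eq : ∀ t : ↥(bset i.D.toDomains),
      Cβ * (torusSupNorm (toKT i).NB (x'.1 - x.1)) ^ β * (((ℓ : ℝ) + 1) ^ i.D.lev x.1) ^ (1 - β)
        * Real.exp (-(δ₀ / 2 * (geomT i.D).dist (blkOf i.D.toDomains x) t))
      = w * (Cβ * ((ℓ : ℝ) + 1) ^ s.1.1 * Real.exp (-(δ₀ / 2 * (geomT i.D).dist s t))) := by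
    intro t
    rw [hlevx, hx, hw, Real.div_rpow htpos.le hLjs.le, Real.rpow_sub hLjs, Real.rpow_one, div_eq_mul_inv, div_eq_mul_inv]
    ring
  -- the side lengths (far case: `s′` only)
  have hsides' : (side i.D s' : ℝ) = ((ℓ : ℝ) + 1) ^ s'.1.1 := by unfold side; push_cast; ring
  have hK₁far : 2 / (side i.D s' : ℝ) ≤ 4 * ((ℓ : ℝ) + 1) / ((ℓ : ℝ) + 1) ^ s'.1.1 := by
    rw [hsides']; exact (far_side_bounds hL1 hLj).1
  have hK₂far : 2 / ((side i.D s' : ℝ) ^ 2) ≤ 12 * ((ℓ : ℝ) + 1) ^ 2 / (((ℓ : ℝ) + 1) ^ s'.1.1) ^ 2 := by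
    rw [hsides']; exact (far_side_bounds hL1 hLj).2
  -- the bound of `Θ` against `Q′`
  have hΘ : ∀ {K₁ K₂ : ℝ}, K₁ ≤ 4 * ((ℓ : ℝ) + 1) / ((ℓ : ℝ) + 1) ^ s'.1.1 →
      K₂ ≤ 12 * ((ℓ : ℝ) + 1) ^ 2 / (((ℓ : ℝ) + 1) ^ s'.1.1) ^ 2 →
      C₁ * ((ℓ : ℝ) + 1) ^ s'.1.1 * (toKT i).supF f * (3 * ((d : ℝ) + 1) * K₂ + C₁ * ((((ℓ : ℝ) + 1) ^ s'.1.1) ^ 2)⁻¹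
          + ((ℓ : ℝ) + 1) ^ 2 / (((ℓ : ℝ) + 1) ^ s'.1.1) ^ 2)
        + 2 * ((d : ℝ) + 1) * K₁ * (C₂ ε * (hqTP (toKT i) ε f + (toKT i).supF f))
        ≤ A ε * (hqTP (toKT i) (β + ε) f + (toKT i).supF f) / ((ℓ : ℝ) + 1) ^ s'.1.1 := by
    intro K₁ K₂ hK₁ hK₂
    have h := theta_le (C₁ := C₁) (C₂ := C₂ ε) (S := (toKT i).supF f) (Q := hqTP (toKT i) ε f + (toKT i).supF f)
      (Lj := ((ℓ : ℝ) + 1) ^ s'.1.1) (L := (ℓ : ℝ) + 1) d hC₁ (hC₂ ε) hS0 hSQ hLj hL1 hK₁ hK₂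
    refine h.trans ?_
    rw [hA, div_le_div_iff_of_pos_right hLj]
    have h0 : 0 ≤ C₁ * (37 * ((d : ℝ) + 1) * ((ℓ : ℝ) + 1) ^ 2 + C₁) + 8 * ((d : ℝ) + 1) * ((ℓ : ℝ) + 1) * C₂ ε := by
      have := hC₂ ε; positivity
    have h1 := mul_le_mul_of_nonneg_left hQQ' h0
    linarith only [h1]
  -- the final assembly, the weight `w` factored out
  have hfinal : ∀ {T Θ : ℝ}, T ≤ C₃ ε β * (hqTP (toKT i) (β + ε) f + (toKT i).supF f) →
      (T ≠ 0 → (bondT i.D).dist s s' ≤ c0 d ℓ + 2 * (d + 1)) →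
      Θ ≤ A ε * (hqTP (toKT i) (β + ε) f + (toKT i).supF f) / ((ℓ : ℝ) + 1) ^ s'.1.1 →
      w * T + Θ * ∑ t ∈ nbhdT i.D s' (rloc d ℓ), Cβ * (torusSupNorm (toKT i).NB (x'.1 - x.1)) ^ β
          * (((ℓ : ℝ) + 1) ^ i.D.lev x.1) ^ (1 - β) * Real.exp (-(δ₀ / 2 * (geomT i.D).dist (blkOf i.D.toDomains x) t))
        ≤ Bc ε β * w * Real.exp (-(δ₀ / 8 * (geomT i.D).dist s s')) * (hqTP (toKT i) (β + ε) f + (toKT i).supF f) := by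
    intro T Θ hT hTnear hΘA
    have key := assemble_le i.D hMh1 hPi hRM1 hδ₀.le hCβ.le hc261 (hA0 ε) hQ'0 (hC₃ ε β) hthr h261D s s' hΘA hT hTnear
    have hsum : Θ * ∑ t ∈ nbhdT i.D s' (rloc d ℓ), Cβ * (torusSupNorm (toKT i).NB (x'.1 - x.1)) ^ β
          * (((ℓ : ℝ) + 1) ^ i.D.lev x.1) ^ (1 - β) * Real.exp (-(δ₀ / 2 * (geomT i.D).dist (blkOf i.D.toDomains x) t))
        = w * (Θ * ∑ t ∈ nbhdT i.D s' (rloc d ℓ), Cβ * ((ℓ : ℝ) + 1) ^ s.1.1 * Real.exp (-(δ₀ / 2 * (geomT i.D).dist s t))) := by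
      simp only [htail_eq]
      rw [← Finset.mul_sum]; ring
    rw [hsum, ← mul_add, hBc]
    calc w * (T + Θ * ∑ t ∈ nbhdT i.D s' (rloc d ℓ), Cβ * ((ℓ : ℝ) + 1) ^ s.1.1 * Real.exp (-(δ₀ / 2 * (geomT i.D).dist s t)))
        ≤ w * ((C₃ ε β * Real.exp (δ₀ / 8 * ((c0 d ℓ + 2 * (d + 1) : ℕ) : ℝ))
            + A ε * Cβ * (c261 * Real.exp (1 / 4 * (3 * δ₀ / 2) * (rloc d ℓ : ℕ))) * Real.exp (δ₀ / 2 * (rloc d ℓ : ℕ))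
              * ((ℓ : ℝ) + 1)) * Real.exp (-(δ₀ / 8 * (geomT i.D).dist s s')) * (hqTP (toKT i) (β + ε) f + (toKT i).supF f)) :=
          mul_le_mul_of_nonneg_left key hw0.le
      _ = _ := by rw [hCfβ]; ring
  -- the two cases
  by_cases hfar : c0 d ℓ + 2 * (d + 1) < (bondT i.D).dist s s'
  · -- FAR
    have hcd := commDatum_far i.D hℓ hMh3 hRi hP4 hrw ha0 ha1 s' hC₁ hAcl hVcl
    have hst := cutoffT_far_stencil i.D s s' hℓ hMh3 hRi hP4 μ hx hfar
    have hst' := cutoffT_far_stencil i.D s s' hℓ hMh3 hRi hP4 μ hx' hfar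
    have hpl := cutoffT_plateau_supp i.D s' hMh1 hPi ν f hsupp
    have hmain := HmajC i.k i.Mh i.R hMh3 hM₀' hRi hRN₀ i.P' hPi hP4 i.D (aPrinted ℓ 1) (fun _ => 1) hwin
      (fun j _ => ⟨le_rfl, le_rfl⟩) hrec (nbhdT i.D s' (rloc d ℓ)) (cutoffT i.D s') Ac Gc Vc _ _ _ _ hGc hGcAc hcd μ ν f x x' 0
      hne' hblk hpl hst hst' _ _ hΦ₀0 hΦ₀c hΦ₁0 hΦ₁
    rw [abs_zero, zero_mul] at hmain
    have h := hfinal (T := 0) (by have := hC₃ ε β; positivity) (fun h => absurd rfl h) (hΘ hK₁far hK₂far)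
    rw [mul_zero] at h
    exact hmain.trans h
  · -- NEAR
    push Not at hfar
    have hcd := commDatum_near i.D hℓ hMh3 hRi hP4 hrw ha0 ha1 s s' hfar hC₁ hAcl hVcl
    have hst := nearCut_near_stencil i.D s s' hMh1 hPi μ hx
    have hst' := nearCut_near_stencil i.D s s' hMh1 hPi μ hx'
    have hpl := nearCut_plateau_supp i.D s s' hMh1 hPi ν f hsupp
    have hmain := HmajC i.k i.Mh i.R hMh3 hM₀' hRi hRN₀ i.P' hPi hP4 i.D (aPrinted ℓ 1) (fun _ => 1) hwin
      (fun j _ => ⟨le_rfl, le_rfl⟩) hrec (nbhdT i.D s' (rloc d ℓ)) (nearCut i.D s s') Ac Gc Vc _ _ _ _ hGc hGcAc hcd μ ν f x x' 1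
      hne' hblk hpl hst hst' _ _ hΦ₀0 hΦ₀c hΦ₁0 hΦ₁
    rw [abs_one, one_mul] at hmain
    -- the near term is the (1.113)-clause for the pair
    have hs_mem : s ∈ nbhdT i.D s' (rloc d ℓ) := by rw [mem_nbhdT]; unfold rloc; omega
    have hT : |((dT (toKT i).NB μ * Gc * (dT (toKT i).NB ν)ᵀ) *ᵥ f) x' - ((dT (toKT i).NB μ * Gc * (dT (toKT i).NB ν)ᵀ) *ᵥ f) x|
        ≤ w * (C₃ ε β * (hqTP (toKT i) (β + ε) f + (toKT i).supF f)) := by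
      rw [Matrix.mul_assoc, ← Matrix.mulVec_mulVec]
      have h := hΦ₂c ε β hε hε1 hβ0 hβ1 μ x x' hblk (by rw [hx]; exact hs_mem) hne
      rw [hx] at h
      rw [hw]
      refine h.trans (le_of_eq ?_)
      ring
    have h := hfinal (T := C₃ ε β * (hqTP (toKT i) (β + ε) f + (toKT i).supF f)) le_rfl (fun _ => hfar) (hΘ le_rfl le_rfl)
    exact hmain.trans ((add_le_add hT le_rfl).trans h)


end Main

/-! ## §5 At NODE 00's layer of letters and at the record -/

section Record

variable {𝔸 : Type} [NormedRing 𝔸] [NormedAlgebra ℂ 𝔸] [CompleteSpace 𝔸]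
variable {G : Subgroup 𝔸ˣ} (𝔏 : ∀ x : MemberY d ℓ hd hL b₀ b₁ Mstar, CovLettersY 𝔸 x)
  (𝔈 : ∀ x : MemberY d ℓ hd hL b₀ b₁ Mstar, ExpLettersY 𝔸 G x)

/-- ★★ **ROW `hGp` AT NODE 00's LAYER OF LETTERS FROM THE LOCAL SECOND-ORDER CLAUSES ALONE** (every `𝔏 𝔈`).
[cite: Balaban1985BackgroundPropagators, Cor. 3.5 p.407 + Thm 3.1 (3.43)–(3.47) p.398; Balaban1984PropagatorsII, Prop. 2.2 (2.67), Lemma 2.1 p.234; Balaban1984PropagatorsI, Prop. 1.2 (1.110)–(1.113) p.36] -/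
theorem residualGpAtOne_letters_of_local (hloc : LocalSecondOrderKIdx d ℓ hd hL b₀ b₁) :
    B9FromB6.ResidualGpAtOne geo9Y (bg9Y 𝔸 G) (fun x => (operatorLayerYOfLetters 𝔸 G x (𝔏 x) (𝔈 x)).Gp) :=
  residualGpAtOne_letters_of_flat 𝔏 𝔈 (ineq344GpKIdx_of_local hloc) (ineq345GpKIdx_of_local hloc)

open scoped Matrix.Norms.L2Operator in
/-- ★★ **ROW `hGp` OF THE N06 KNIT AT THE RECORD'S LAYER OF LETTERS FROM `LocalSecondOrderKIdx` ALONE** — conclusion LITERALLY the knit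
binder `hGp` at `ops := opsYOfLetters N θ M⋆ 𝔏 𝔈`; the one displayed hypothesis is the local second-order schema of a comparison
operator around each source block ([B5] Prop. 1.2's clauses for the charted cube operator).
[cite: Balaban1985BackgroundPropagators, Cor. 3.5 p.407 + Thm 3.1 (3.43)–(3.47) p.398; Balaban1984PropagatorsI, Prop. 1.2 (1.110)–(1.113) p.36] -/
theorem hGp_opsYOfLetters_of_local (N : ℕ) (θ : Stage3Params) (Mstar' : ℕ) (𝔏 : LettersY N θ Mstar') (𝔈 : ExpsY N θ Mstar')
    (hloc : LocalSecondOrderKIdx θ.d₆ θ.ℓ₆ θ.hd' θ.hL' θ.b₀ θ.b₁) :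
    B9FromB6.ResidualGpAtOne geo9Y (bg9Y (Matrix (Fin N) (Fin N) ℂ) (specialUnitaryUnits (Fin N)))
      (fun x => (opsYOfLetters N θ Mstar' 𝔏 𝔈 x).Gp) :=
  residualGpAtOne_letters_of_local 𝔏 𝔈 hloc

end Record

end Literature.MathematicalPhysics.QuantumFieldTheory.Balaban1983to89.B9Ineq344LocalToKIdx

end
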